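import Summits.AtomisticToContinuum.Crystallization.Theorems.FrustratedLawDichotomyStrainedPatchHomEntrySemanticFcc
import Summits.AtomisticToContinuum.Crystallization.Theorems.FrustratedLawDichotomyStrainedPatchHomForceCentredHcp

/-!
# Strained patch, `(H)` certificates — LEAF FAMILIES for the manifest fold: any sound leaf verdict, μ-free geometric verdicts (force rings) at EVERY level, and the
# kernel-evaluable hcp leaves already in the tree (`entryLeafOKHQ` far field, `forceOutCM` centred force prune, `entryLeafOKHC = HQ ∨ forceOutCM`) as semantic leaves
# (27623 `(H) HomFloor`, column architecture «R» of critic row 1469 (A), gate G4 glue; decomp-a2c hand 2, generation 39; DEF-FREE)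

Critic row 1469 (A4) G4: «hand-2 types the glue `semOKH_of_ringOK : ringOK … c w = true → semOKH μ c w = true` (soundness = `exemptNear_of_forceB_gt` ∘ the enclosure chain;
level-free since the first disjunct does not mention μ), hand-1 the Bool verdict + its enclosure soundness»; the draw manifest per `2⁻⁸` frame is
`[U-cuts] → [ξ-cuts at the common tilted slab] → [ring leaves outside] → [inside: one slab-shaped T-cell each]`, closed by `semOKH_root_of_manifest … (by decide)`.
`…HomCutTree` (p854043; this file imports it through `…HomEntrySemanticFcc` p854053 for the fcc twin) fixed the fold for ONE leaf family at a time (`coveredAt L`, or a kernel verdict); a production column mixes leaf KINDS.  This module types,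
once and for all and before `ringOK` exists:

* §1 ★ `semOKH_of_cutOK_leaves` — THE MASTER GLUE: for ANY leaf family `leafOK : α → box → Bool` whose every accepted leaf is a semantic fact at level `μ`
  (`hleaf : ∀ a c w, leafOK a c w = true → semOKH μ c w = true`), `cutOK leafOK t c w = true → semOKH μ c w = true`; fcc twin `semOKF_of_cutOK_leaves`.  A new leaf
  kind (hand-1's `ringOK`) costs ONE case of `hleaf`.
* §2 ★ `semOKH_of_geomSound` — a verdict whose soundness yields the GEOMETRIC trichotomy (the μ-free first disjunct of `HcpLeafGoal`) certifies the box at EVERY level;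
  `semOKH_of_exemptSound` — the ring shape: soundness yields `ExemptNear (9/5) ExRec` for every presenting cluster.  So `semOKH_of_ringOK` will be
  `semOKH_of_exemptSound ringOK ringOK_exempt` (or `semOKH_of_sound ringOK ringOK_sound` if hand-1 states it in the full `hver` shape).
* §3 the kernel-evaluable hcp leaves ALREADY in the tree as semantic leaves: `semOKH_of_forceOutCM` (every μ), `semOKH_of_entryLeafOKHC` / `_level` (`HQ ∨ forceOutCM` at
  `μ₀ ≥ μ`) — the far field `d ≳ 4.5e-2` of hand-1's FINDING (R25-shape HQ boxes pass `decide` in ≈ 3 s) is therefore a manifest leaf TODAY.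
* §4 ★★ THE PRODUCTION MENU `colLeaf L μ₀ : ℕ ⊕ Unit → box → Bool` — `Sum.inl i` = listed landed cell (containment in `L[i]`), `Sum.inr ()` = kernel leaf `entryLeafOKHC μ₀`
  (far field / centred force prune) — with `semOKH_of_cutOK_colLeaf (hle : μ ≤ μ₀)` and the root form `semOKH_root_of_colManifest`; the ring kind is added by §1 when it lands.

No definitions except the transparent abbreviation-free menu function `colLeaf` (a `def` of a Bool function, computable); 0 sorry; standard axioms.
`--supports stmt-AtomisticToContinuum-27623`.  [formal bookkeeping]
-/

namespace Summit.AtomisticToContinuum.Crystallization.Theorems.FrustratedLawDichotomyStrainedPatchHomCutTree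

open scoped RealInnerProductSpace
open Literature.Analysis.ValidatedNumerics.Numerics
open Summit.AtomisticToContinuum.Crystallization.Theorems.ChargedEnergyGapNegative (E3)
open Summit.AtomisticToContinuum.Crystallization.Theorems.FrustratedLawDichotomyAveragingRuleTightFree (TightNearCap BadNearCap)
open Summit.AtomisticToContinuum.Crystallization.Theorems.FrustratedLawDichotomyExemptAbsorption (ExemptNear)
open Summit.AtomisticToContinuum.Crystallization.Theorems.FrustratedLawDichotomyStrainedPatchHomSplit (ExRec latPt hexFrame hcpShift)
open Summit.AtomisticToContinuum.Crystallization.Theorems.FrustratedLawDichotomyStrainedPatchHomEntryGram (rootC rootW)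
open Summit.AtomisticToContinuum.Crystallization.Theorems.FrustratedLawDichotomyStrainedPatchHomEntryGramHcp (rootCH rootWH)
open Summit.AtomisticToContinuum.Crystallization.Theorems.FrustratedLawDichotomyStrainedPatchHomEntryLeafHT (HcpLeafGoal semOKH semOKH_of_sound semOKH_anti_box
  semOKH_mono_level semOKF semOKF_anti_box semOKF_cut)
open Summit.AtomisticToContinuum.Crystallization.Theorems.FrustratedLawDichotomyStrainedPatchHomForceCentredHcp (forceOutCM forceOutCM_sound entryLeafOKHC
  entryLeafOKHC_sound)

/-! ## §1 ★ The master glue: any leaf family whose accepted leaves are semantic facts -/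

/-- ★ **MASTER GLUE (hcp)**: a cut tree over ANY leaf family `leafOK : α → box → Bool` certifies its root box at level `μ` as soon as every accepted leaf is a semantic
fact at level `μ`.  New leaf kinds (listed cells, kernel verdicts, force rings, far field, sub-manifests) each cost one case of `hleaf`. [formal bookkeeping] -/
theorem semOKH_of_cutOK_leaves {μ : ℤ} {α : Type} (leafOK : α → ((Fin 3 × Fin 3) ⊕ Fin 3 → ℤ) → ((Fin 3 × Fin 3) ⊕ Fin 3 → ℤ) → Bool)
    (hleaf : ∀ (a : α) (c w : (Fin 3 × Fin 3) ⊕ Fin 3 → ℤ), leafOK a c w = true → semOKH μ c w = true) :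
    ∀ (t : CutTree ((Fin 3 × Fin 3) ⊕ Fin 3) α) (c w : (Fin 3 × Fin 3) ⊕ Fin 3 → ℤ), cutOK leafOK t c w = true → semOKH μ c w = true :=
  cutOK_sound (semOKH μ) leafOK hleaf (fun k u c w hl hr => semOKH_cut k u c w hl hr)

/-- ★ **MASTER GLUE (fcc)**, likewise. [formal bookkeeping] -/
theorem semOKF_of_cutOK_leaves {μ : ℤ} {α : Type} (leafOK : α → (Fin 3 × Fin 3 → ℤ) → (Fin 3 × Fin 3 → ℤ) → Bool)
    (hleaf : ∀ (a : α) (c w : Fin 3 × Fin 3 → ℤ), leafOK a c w = true → semOKF μ c w = true) :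
    ∀ (t : CutTree (Fin 3 × Fin 3) α) (c w : Fin 3 × Fin 3 → ℤ), cutOK leafOK t c w = true → semOKF μ c w = true :=
  cutOK_sound (semOKF μ) leafOK hleaf (fun k u c w hl hr => semOKF_cut k u c w hl hr)

/-! ## §2 ★ μ-free geometric verdicts (force rings) certify at EVERY level -/

/-- ★ **A GEOMETRIC VERDICT CERTIFIES AT EVERY LEVEL**: if the soundness of `verdict` yields, for every admissible `(U, ξ)` of the box, the geometric trichotomy
`TightNearCap ∨ ExemptNear ∨ BadNearCap` for every finite cluster presenting the strained hcp environment (the μ-FREE first disjunct of `HcpLeafGoal`), then an accepted box is a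
semantic fact at every level `μ`. [formal bookkeeping] -/
theorem semOKH_of_geomSound (verdict : ((Fin 3 × Fin 3) ⊕ Fin 3 → ℤ) → ((Fin 3 × Fin 3) ⊕ Fin 3 → ℤ) → Bool)
    (hgeo : ∀ c w, verdict c w = true → ∀ (U : E3 →L[ℝ] E3) (ξ : E3), (∀ v v' : E3, ⟪U v, v'⟫ = ⟪v, U v'⟫) → ‖U - 1‖ ≤ 1 / 4 →
      (∀ ab : Fin 3 × Fin 3, |(U (EuclideanSpace.single ab.2 (1 : ℝ))) ab.1 - (c (Sum.inl ab) : ℝ) / SC| ≤ (w (Sum.inl ab) : ℝ) / SC) →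
      (∀ i : Fin 3, |ξ i - (c (Sum.inr i) : ℝ) / SC| ≤ (w (Sum.inr i) : ℝ) / SC) → 0 ≤ ξ 0 → 0 ≤ ξ 2 →
      ∀ (M : ℕ) (z : Fin M → E3) (cc : Fin M), Function.Injective z →
        Set.range z = {x : E3 | dist x (z cc) ≤ 133 / 10 ∧ ∃ a : Fin 3 → ℤ,
          x = z cc + latPt U hexFrame a ∨ x = z cc + latPt U hexFrame a + U (hcpShift + ξ)} →
        TightNearCap (9 / 5) (3 / 2) z cc ∨ ExemptNear (9 / 5) ExRec z cc ∨ BadNearCap (9 / 5) (3 / 2) z cc)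
    {c w : (Fin 3 × Fin 3) ⊕ Fin 3 → ℤ} (h : verdict c w = true) (μ : ℤ) : semOKH μ c w = true :=
  semOKH_of_sound (μ := μ) verdict (fun c w hv U ξ hsa hU hbox hξ h0 h2 => Or.inl (hgeo c w hv U ξ hsa hU hbox hξ h0 h2)) h

/-- ★ **THE RING SHAPE**: a verdict whose soundness yields `ExemptNear (9/5) ExRec` (some reach site is force-unstable) for every presenting cluster certifies the box at every
level — the statement hand-1's `ringOK_sound` will have (via `exemptNear_of_forceB_gt` ∘ the signed outward-force enclosure). [formal bookkeeping] -/
theorem semOKH_of_exemptSound (verdict : ((Fin 3 × Fin 3) ⊕ Fin 3 → ℤ) → ((Fin 3 × Fin 3) ⊕ Fin 3 → ℤ) → Bool)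
    (hex : ∀ c w, verdict c w = true → ∀ (U : E3 →L[ℝ] E3) (ξ : E3), (∀ v v' : E3, ⟪U v, v'⟫ = ⟪v, U v'⟫) → ‖U - 1‖ ≤ 1 / 4 →
      (∀ ab : Fin 3 × Fin 3, |(U (EuclideanSpace.single ab.2 (1 : ℝ))) ab.1 - (c (Sum.inl ab) : ℝ) / SC| ≤ (w (Sum.inl ab) : ℝ) / SC) →
      (∀ i : Fin 3, |ξ i - (c (Sum.inr i) : ℝ) / SC| ≤ (w (Sum.inr i) : ℝ) / SC) → 0 ≤ ξ 0 → 0 ≤ ξ 2 →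
      ∀ (M : ℕ) (z : Fin M → E3) (cc : Fin M), Function.Injective z →
        Set.range z = {x : E3 | dist x (z cc) ≤ 133 / 10 ∧ ∃ a : Fin 3 → ℤ,
          x = z cc + latPt U hexFrame a ∨ x = z cc + latPt U hexFrame a + U (hcpShift + ξ)} →
        ExemptNear (9 / 5) ExRec z cc)
    {c w : (Fin 3 × Fin 3) ⊕ Fin 3 → ℤ} (h : verdict c w = true) (μ : ℤ) : semOKH μ c w = true :=
  semOKH_of_geomSound verdict
    (fun c w hv U ξ hsa hU hbox hξ h0 h2 M z cc hz hr => Or.inr (Or.inl (hex c w hv U ξ hsa hU hbox hξ h0 h2 M z cc hz hr))) h μ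

/-! ## §3 The kernel-evaluable hcp leaves already in the tree, as semantic leaves -/

/-- ★ **THE CENTRED FORCE PRUNE `forceOutCM` IS A SEMANTIC LEAF AT EVERY LEVEL** (its soundness is the μ-free prune disjunct). [formal bookkeeping] -/
theorem semOKH_of_forceOutCM {c w : (Fin 3 × Fin 3) ⊕ Fin 3 → ℤ} (h : forceOutCM c w = true) (μ : ℤ) : semOKH μ c w = true :=
  semOKH_of_sound (μ := μ) (fun c w => forceOutCM c w) (fun _ _ hv U ξ hsa hU hbox hξ h0 h2 => forceOutCM_sound (μ := μ) hv U ξ hsa hU hbox hξ h0 h2) h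

/-- ★ **`entryLeafOKHC μ = entryLeafOKHQ μ ∨ forceOutCM` (far field / force prune) IS A SEMANTIC LEAF at level `μ`.** [formal bookkeeping] -/
theorem semOKH_of_entryLeafOKHC {μ : ℤ} {c w : (Fin 3 × Fin 3) ⊕ Fin 3 → ℤ} (h : entryLeafOKHC μ c w = true) : semOKH μ c w = true :=
  semOKH_of_sound (entryLeafOKHC μ) (fun _ _ hv U ξ hsa hU hbox hξ h0 h2 => entryLeafOKHC_sound hv U ξ hsa hU hbox hξ h0 h2) h

/-- … and at every lower level (`μ ≤ μ₀`: far-field boxes checked once at `muRec` serve `μ₇₄`). [formal bookkeeping] -/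
theorem semOKH_of_entryLeafOKHC_level {μ μ₀ : ℤ} (hle : μ ≤ μ₀) {c w : (Fin 3 × Fin 3) ⊕ Fin 3 → ℤ} (h : entryLeafOKHC μ₀ c w = true) :
    semOKH μ c w = true :=
  semOKH_mono_level hle (semOKH_of_entryLeafOKHC h)

/-- Kernel-leaf cut trees over `entryLeafOKHC μ₀` (far field + force prune only; e.g. the exterior of all columns). [formal bookkeeping] -/
theorem semOKH_of_cutOK_entryLeafOKHC {μ μ₀ : ℤ} (hle : μ ≤ μ₀) :
    ∀ (t : CutTree ((Fin 3 × Fin 3) ⊕ Fin 3) Unit) (c w : (Fin 3 × Fin 3) ⊕ Fin 3 → ℤ),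
      cutOK (fun _ => entryLeafOKHC μ₀) t c w = true → semOKH μ c w = true :=
  semOKH_of_cutOK_leaves (fun _ => entryLeafOKHC μ₀) (fun _ _ _ h => semOKH_of_entryLeafOKHC_level hle h)

/-! ## §4 ★★ The production menu: listed landed cells + kernel far-field / force-prune leaves in ONE tree -/

/-- **THE COLUMN LEAF MENU**: `Sum.inl i` — the leaf box is contained in the listed certified box `L[i]`; `Sum.inr ()` — the leaf box passes the kernel verdict
`entryLeafOKHC μ₀` (`HQ` far field or centred force prune).  Computable. -/
def colLeaf (L : List (((Fin 3 × Fin 3) ⊕ Fin 3 → ℤ) × ((Fin 3 × Fin 3) ⊕ Fin 3 → ℤ))) (μ₀ : ℤ) :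
    ℕ ⊕ Unit → ((Fin 3 × Fin 3) ⊕ Fin 3 → ℤ) → ((Fin 3 × Fin 3) ⊕ Fin 3 → ℤ) → Bool
  | .inl i, c, w => coveredAt L i c w
  | .inr _, c, w => entryLeafOKHC μ₀ c w

/-- ★★ **THE MENU FOLD**: listed cells certified at `μ` + kernel leaves at `μ₀ ≥ μ` + ONE `decide` on `cutOK (colLeaf L μ₀) t c w` ⟹ `semOKH μ c w = true`. [formal bookkeeping] -/
theorem semOKH_of_cutOK_colLeaf {μ μ₀ : ℤ} (hle : μ ≤ μ₀) (L : List (((Fin 3 × Fin 3) ⊕ Fin 3 → ℤ) × ((Fin 3 × Fin 3) ⊕ Fin 3 → ℤ)))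
    (hL : ∀ b ∈ L, semOKH μ b.1 b.2 = true) :
    ∀ (t : CutTree ((Fin 3 × Fin 3) ⊕ Fin 3) (ℕ ⊕ Unit)) (c w : (Fin 3 × Fin 3) ⊕ Fin 3 → ℤ), cutOK (colLeaf L μ₀) t c w = true → semOKH μ c w = true :=
  semOKH_of_cutOK_leaves (colLeaf L μ₀) fun a c w h => by
    rcases a with i | u
    · exact coveredAt_sound (semOKH μ) (fun _ _ _ _ hc h => semOKH_anti_box hc h) L hL i c w h
    · exact semOKH_of_entryLeafOKHC_level hle h

/-- ★★ **THE hcp ROOT FACT FROM A MENU MANIFEST** of the root cube. [formal bookkeeping] -/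
theorem semOKH_root_of_colManifest {μ μ₀ : ℤ} (hle : μ ≤ μ₀) (L : List (((Fin 3 × Fin 3) ⊕ Fin 3 → ℤ) × ((Fin 3 × Fin 3) ⊕ Fin 3 → ℤ)))
    (hL : ∀ b ∈ L, semOKH μ b.1 b.2 = true) (t : CutTree ((Fin 3 × Fin 3) ⊕ Fin 3) (ℕ ⊕ Unit)) (h : cutOK (colLeaf L μ₀) t rootCH rootWH = true) :
    semOKH μ rootCH rootWH = true :=
  semOKH_of_cutOK_colLeaf hle L hL t rootCH rootWH h

/-- SUB-MANIFESTS COMPOSE: a column (or frame) certified by its own manifest is a listable box for the parent manifest. [formal bookkeeping] -/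
theorem semFacts_cons_of_colManifest {μ μ₀ : ℤ} (hle : μ ≤ μ₀) {c w : (Fin 3 × Fin 3) ⊕ Fin 3 → ℤ}
    (L L' : List (((Fin 3 × Fin 3) ⊕ Fin 3 → ℤ) × ((Fin 3 × Fin 3) ⊕ Fin 3 → ℤ)))
    (hL : ∀ b ∈ L, semOKH μ b.1 b.2 = true) (hL' : ∀ b ∈ L', semOKH μ b.1 b.2 = true)
    (t : CutTree ((Fin 3 × Fin 3) ⊕ Fin 3) (ℕ ⊕ Unit)) (h : cutOK (colLeaf L μ₀) t c w = true) : ∀ b ∈ ((c, w) :: L'), semOKH μ b.1 b.2 = true :=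
  semFacts_cons (semOKH_of_cutOK_colLeaf hle L hL t c w h) hL'

end Summit.AtomisticToContinuum.Crystallization.Theorems.FrustratedLawDichotomyStrainedPatchHomCutTree
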